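import Summits.CriticalPhenomena.PercolationContinuityZ3.Theorems.PercNearOneGluingNoHeavyLowerTailIncStarTwoCutMoments
import Summits.CriticalPhenomena.PercolationContinuityZ3.Theorems.PercNearOneGluingNoHeavyLowerTailIncStarTwoCutReal
import Mathlib.Tactic.LinearCombination
import HarnessLib

/-!
# Two-cuts with the root and one target on the root side (MODE B), XI: THEOREM B⁺ conditional on the near lemma (N⁺)

Support file for the Sahi programme (`--supports stmt-CriticalPhenomena-4575`, prover prim-sahi-p2 gen 27).  No definitions, no named
facts, no sorries; standard axioms.  Memos `run/shared/lean/prim/prim-sahi/FROM-prim-sahi-p2-gen25-MODE-B-CONE.md` §3–§4b,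
`…/FROM-prim-sahi-p2-gen26-NEAR-LEMMA.md`, `…/FROM-prim-sahi-p2-gen27-BPLUS-GLUE.md`.

**THEOREM B⁺ (the '2|1 with the root on the 1-side' two-separation), conditional form** (`incStar_nonneg_of_twoCut_rootSideTarget`).
In the setting of `…IncStarTwoCutMoments` (root side `R ∋ s`, ports `u, v`, root-side target `a`, outside targets `b, c`):

  (N⁺) [the eight cone rows of `IncStarTwoCut.twoCut_Apart_nonneg` for `u′ = u_A − θu·u_u − θv·u_v`, `θu·qY = dY`, `θv·qX = dX`]
  ∧ `0 ≤ E₃({s↔u},{s↔b},{s↔c})` ∧ `0 ≤ E₃({s↔v},{s↔b},{s↔c})`  ⟹  `0 ≤ E₃({s↔a},{s↔b},{s↔c})`.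

Of the eight rows, seven (`hN1`–`hN7`: positivity and the Harris rows) are theorems of the near side (parts IV–IX: van den Berg–Kahn
Thm 1.2, BHK Thm 1.3 with and without a root set, Harris — stated there for a standalone weighted graph; the transfer to the root-side
pairs of a two-cut is routine and not done here), and ONE — `hN8`, the STAR row `S(u′) ≥ 0` — is OPEN (it follows from the τ-free inequality
(V2) of the gen-26 memo, three-copy fibre-positive on `K₄, K₅, K₆`).  The two moved-target stars are instances of the increasing star on a
graph with fewer vertices (the root side becomes targetless) and are inductively available.  Proof: (R1) at `t = a, u, v`
(`twoCut_sahiE3_rootSide_eq`), the assembly (B1) `E₃(a) = value(u′) + θu·E₃(u) + θv·E₃(v)` and Step 1 `value(u′) = PP + κ·Cov` (one ring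
identity, closed by `linear_combination`), and the A-part real core `twoCut_Apart_nonneg`; the outside inputs of the core (type marginals,
Harris for the three outside covariances, monotonicity `P(Pb ∩ Pc) ≤ P((Pb ∪ Qb) ∩ (Pc ∪ Qc))`) and the class-law constraints (Harris for
`Xu, Xv`) are discharged here.
-/

noncomputable section

namespace Summit.CriticalPhenomena.PercolationContinuityZ3.Theorems

namespace IncStarTwoCut

open MeasureTheory Set Literature.Probability.Percolation Literature.Probability.LatticeModels
open IncStarOneTargetSide
open scoped Classical

variable {n : ℕ}

/-! ### THEOREM B⁺ (conditional on the near lemma (N⁺)) -/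

/-- Splitting a union into the two differences and the intersection. [folklore] -/
theorem real_union_three {μ : Measure (BondConfig (Fin n))} [IsFiniteMeasure μ] (P Q : Set (BondConfig (Fin n))) :
    μ.real (P ∪ Q) = μ.real (P \ Q) + μ.real (Q \ P) + μ.real (P ∩ Q) := by
  have hm : ∀ X : Set (BondConfig (Fin n)), MeasurableSet X := fun _ => MeasurableSet.of_discrete
  have hset : P ∪ Q = ((P \ Q) ∪ (Q \ P)) ∪ (P ∩ Q) := by
    ext ω; simp only [Set.mem_union, Set.mem_sdiff, Set.mem_inter_iff]; tauto
  rw [hset, measureReal_union ?_ (hm _), measureReal_union ?_ (hm _)]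
  · exact Set.disjoint_left.2 fun ω h h' => h.2 h'.1
  · exact Set.disjoint_left.2 fun ω h h' => by
      rcases h with h | h
      · exact h.2 h'.2
      · exact h.2 h'.1

/-- `P(P) = P(P ∖ Q) + P(P ∩ Q)`. [folklore] -/
theorem real_sdiff_add_inter {μ : Measure (BondConfig (Fin n))} [IsFiniteMeasure μ] (P Q : Set (BondConfig (Fin n))) :
    μ.real P = μ.real (P \ Q) + μ.real (P ∩ Q) := by
  have h := measureReal_inter_add_sdiff (μ := μ) (s := P) (t := Q) MeasurableSet.of_discrete
  linarith

set_option maxHeartbeats 1600000 in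
/-- **THEOREM B⁺, conditional form (the '2|1 with the root on the 1-side' two-separation).**  Product Bernoulli bond percolation
`prodBernoulli w` on `Fin n`; a root side `R ∋ s`, separating vertices `u, v` (meant to lie outside `R`) with no positive pair from `R`
to the outside of `R ∪ {u, v}`; the lone root-side target `a ∈ R ∪ {u, v}` and the targets `b, c ∉ R` outside.  Root-side numbers (pairs meeting `R` only,
`p ~_F q`): the class law `qX = P(s~u only)`, `qY = P(s~v only)`, `qW = P(s~u, s~v)`, the class vector of `A = {s ~_F a}`
(`a0, aX, aY, aW`), and the port-swap numbers `dX = P(a ~_F v, class X, ¬A)`, `dY = P(a ~_F u, class Y, ¬A)`; `θu·qY = dY`, `θv·qX = dX`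
(`θ ≥ 0`; the memo's `θ_x = d_x/q_Y`, `θ_y = d_y/q_X`).  HYPOTHESES: the near lemma (N⁺) of the memo — the eight cone rows of
`IncStarTwoCut.twoCut_Apart_nonneg` for the vector `u′ = u_A − θu·u_u − θv·u_v` (`hN1`–`hN7` are proved on the near side in parts IV–IX up
to the transfer from a standalone near graph; `hN8`, the STAR row, is OPEN: it follows from (V2) of the gen-26 memo) — and the two
MOVED-TARGET stars `E₃({s↔u},{s↔b},{s↔c}) ≥ 0`, `E₃({s↔v},{s↔b},{s↔c}) ≥ 0` (inductively available).  CONCLUSION: `0 ≤ E₃({s↔a},{s↔b},{s↔c})`.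
Proof: (R1) of `twoCut_sahiE3_rootSide_eq` at `t = a, u, v`, the assembly (B1)
`E₃(a) = value(u′) + θu·E₃(u) + θv·E₃(v)`, Step 1 `value(u′) = PP + κ·Cov` (a ring identity) and the A-part real core; the outside inputs of the
core (type marginals, Harris for the three outside covariances, `P(Pb ∩ Pc) ≤ P((Pb ∪ Qb) ∩ (Pc ∪ Qc))`) and the class-law constraints
(Harris for `Xu, Xv`) are discharged here. [this work] -/
theorem incStar_nonneg_of_twoCut_rootSideTarget (w : Sym2 (Fin n) → unitInterval) (R : Set (Fin n)) {s u v a b c : Fin n}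
    (hs : s ∈ R) (ha : a ∈ R ∨ a = u ∨ a = v) (hb : b ∉ R) (hc : c ∉ R)
    (hw : ∀ x ∈ R, ∀ z, z ∉ R → z ≠ u → z ≠ v → w s(x, z) = 0)
    {F : Set (Sym2 (Fin n))} (hF : F = {e : Sym2 (Fin n) | ∃ y ∈ R, y ∈ e})
    {Xu Xv Ba Va Ua : Set (BondConfig (Fin n))}
    (hXu : Xu = {ω | ω ∩ F ∈ (openConn s u : Set (BondConfig (Fin n)))})
    (hXv : Xv = {ω | ω ∩ F ∈ (openConn s v : Set (BondConfig (Fin n)))})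
    (hBa : Ba = {ω | ω ∩ F ∈ (openConn s a : Set (BondConfig (Fin n)))})
    (hVa : Va = {ω | ω ∩ F ∈ (openConn v a : Set (BondConfig (Fin n)))})
    (hUa : Ua = {ω | ω ∩ F ∈ (openConn u a : Set (BondConfig (Fin n)))})
    {qX qY qW a0 aX aY aW dX dY θu θv : ℝ}
    (hqX : qX = (prodBernoulli w).real (Xu \ Xv)) (hqY : qY = (prodBernoulli w).real (Xv \ Xu))
    (hqW : qW = (prodBernoulli w).real (Xu ∩ Xv))
    (ha0 : a0 = (prodBernoulli w).real (Ba ∩ (Xu ∪ Xv)ᶜ)) (haX : aX = (prodBernoulli w).real (Ba ∩ (Xu \ Xv)))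
    (haY : aY = (prodBernoulli w).real (Ba ∩ (Xv \ Xu))) (haW : aW = (prodBernoulli w).real (Ba ∩ (Xu ∩ Xv)))
    (hdX : dX = (prodBernoulli w).real ((Ba ∪ Va) ∩ (Xu \ Xv)) - (prodBernoulli w).real (Ba ∩ (Xu \ Xv)))
    (hdY : dY = (prodBernoulli w).real ((Ba ∪ Ua) ∩ (Xv \ Xu)) - (prodBernoulli w).real (Ba ∩ (Xv \ Xu)))
    (hθu0 : 0 ≤ θu) (hθv0 : 0 ≤ θv) (hθu : θu * qY = dY) (hθv : θv * qX = dX)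
    -- the near lemma (N⁺): the cone rows for u′ = (aX − θu qX, aY − θv qY, aW − (θu+θv) qW ; α′)
    (hN1 : 0 ≤ aX - θu * qX) (hN2 : 0 ≤ aY - θv * qY) (hN3 : 0 ≤ aW - (θu + θv) * qW)
    (hN4 : (qX + qW) * (a0 + aX + aY + aW - θu * (qX + qW) - θv * (qY + qW)) ≤ (aX - θu * qX) + (aW - (θu + θv) * qW))
    (hN5 : (qY + qW) * (a0 + aX + aY + aW - θu * (qX + qW) - θv * (qY + qW)) ≤ (aY - θv * qY) + (aW - (θu + θv) * qW))
    (hN6 : (qX + qW + (qY + qW) - qW) * (a0 + aX + aY + aW - θu * (qX + qW) - θv * (qY + qW))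
      ≤ (aX - θu * qX) + (aY - θv * qY) + (aW - (θu + θv) * qW))
    (hN7 : qW * (a0 + aX + aY + aW - θu * (qX + qW) - θv * (qY + qW)) ≤ aW - (θu + θv) * qW)
    (hN8 : 0 ≤ 2 * (aW - (θu + θv) * qW) - ((aX - θu * qX) + (aW - (θu + θv) * qW)) * (qY + qW)
      - ((aY - θv * qY) + (aW - (θu + θv) * qW)) * (qX + qW)
      - (qW - (qX + qW) * (qY + qW)) * (a0 + aX + aY + aW - θu * (qX + qW) - θv * (qY + qW)))
    -- the two moved-target stars
    (hMu : 0 ≤ sahiE3 (prodBernoulli w) (openConn s u) (openConn s b) (openConn s c))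
    (hMv : 0 ≤ sahiE3 (prodBernoulli w) (openConn s v) (openConn s b) (openConn s c)) :
    0 ≤ sahiE3 (prodBernoulli w) (openConn s a) (openConn s b) (openConn s c) := by
  have hmeas : ∀ X : Set (BondConfig (Fin n)), MeasurableSet X := fun _ => MeasurableSet.of_discrete
  -- outside events and reals
  obtain ⟨Pb, hPb⟩ : ∃ S : Set (BondConfig (Fin n)), S = openConnIn Rᶜ u b := ⟨_, rfl⟩
  obtain ⟨Qb, hQb⟩ : ∃ S : Set (BondConfig (Fin n)), S = openConnIn Rᶜ v b := ⟨_, rfl⟩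
  obtain ⟨Pc, hPc⟩ : ∃ S : Set (BondConfig (Fin n)), S = openConnIn Rᶜ u c := ⟨_, rfl⟩
  obtain ⟨Qc, hQc⟩ : ∃ S : Set (BondConfig (Fin n)), S = openConnIn Rᶜ v c := ⟨_, rfl⟩
  obtain ⟨ζ, hζ⟩ : ∃ r : ℝ, r = (prodBernoulli w).real (openConnIn Rᶜ u v) := ⟨_, rfl⟩
  obtain ⟨bx, hbx⟩ : ∃ r : ℝ, r = (prodBernoulli w).real Pb := ⟨_, rfl⟩
  obtain ⟨by_, hby⟩ : ∃ r : ℝ, r = (prodBernoulli w).real Qb := ⟨_, rfl⟩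
  obtain ⟨bU, hbU⟩ : ∃ r : ℝ, r = (prodBernoulli w).real (Pb ∪ Qb) := ⟨_, rfl⟩
  obtain ⟨bN, hbN⟩ : ∃ r : ℝ, r = (prodBernoulli w).real (Pb ∩ Qb) := ⟨_, rfl⟩
  obtain ⟨cx, hcx⟩ : ∃ r : ℝ, r = (prodBernoulli w).real Pc := ⟨_, rfl⟩
  obtain ⟨cy, hcy⟩ : ∃ r : ℝ, r = (prodBernoulli w).real Qc := ⟨_, rfl⟩
  obtain ⟨cU, hcU⟩ : ∃ r : ℝ, r = (prodBernoulli w).real (Pc ∪ Qc) := ⟨_, rfl⟩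
  obtain ⟨cN, hcN⟩ : ∃ r : ℝ, r = (prodBernoulli w).real (Pc ∩ Qc) := ⟨_, rfl⟩
  obtain ⟨mxx, hmxx⟩ : ∃ r : ℝ, r = (prodBernoulli w).real (Pb ∩ Pc) := ⟨_, rfl⟩
  obtain ⟨myy, hmyy⟩ : ∃ r : ℝ, r = (prodBernoulli w).real (Qb ∩ Qc) := ⟨_, rfl⟩
  obtain ⟨mU, hmU⟩ : ∃ r : ℝ, r = (prodBernoulli w).real ((Pb ∪ Qb) ∩ (Pc ∪ Qc)) := ⟨_, rfl⟩
  obtain ⟨mN, hmN⟩ : ∃ r : ℝ, r = (prodBernoulli w).real ((Pb ∩ Qb) ∩ (Pc ∩ Qc)) := ⟨_, rfl⟩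
  obtain ⟨bpx, hbpx⟩ : ∃ r : ℝ, r = (prodBernoulli w).real (Pb \ Qb) := ⟨_, rfl⟩
  obtain ⟨bpy, hbpy⟩ : ∃ r : ℝ, r = (prodBernoulli w).real (Qb \ Pb) := ⟨_, rfl⟩
  obtain ⟨cpx, hcpx⟩ : ∃ r : ℝ, r = (prodBernoulli w).real (Pc \ Qc) := ⟨_, rfl⟩
  obtain ⟨cpy, hcpy⟩ : ∃ r : ℝ, r = (prodBernoulli w).real (Qc \ Pc) := ⟨_, rfl⟩
  -- outside facts
  have hbxs : bx = bpx + bN := by rw [hbx, hbpx, hbN]; exact real_sdiff_add_inter Pb Qb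
  have hbys : by_ = bpy + bN := by rw [hby, hbpy, hbN, Set.inter_comm]; exact real_sdiff_add_inter Qb Pb
  have hbUs : bU = bpx + bpy + bN := by rw [hbU, hbpx, hbpy, hbN]; exact real_union_three Pb Qb
  have hcxs : cx = cpx + cN := by rw [hcx, hcpx, hcN]; exact real_sdiff_add_inter Pc Qc
  have hcys : cy = cpy + cN := by rw [hcy, hcpy, hcN, Set.inter_comm]; exact real_sdiff_add_inter Qc Pc
  have hcUs : cU = cpx + cpy + cN := by rw [hcU, hcpx, hcpy, hcN]; exact real_union_three Pc Qc
  have upO : ∀ p q : Fin n, IsUpperSet (openConnIn Rᶜ p q : Set (BondConfig (Fin n))) := fun p q => isUpperSet_openConnIn Rᶜ p q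
  have upPb : IsUpperSet Pb := by rw [hPb]; exact upO u b
  have upQb : IsUpperSet Qb := by rw [hQb]; exact upO v b
  have upPc : IsUpperSet Pc := by rw [hPc]; exact upO u c
  have upQc : IsUpperSet Qc := by rw [hQc]; exact upO v c
  have hcovX : 0 ≤ mxx - bx * cx := by
    have h := prodBernoulli_harris w upPb upPc (hmeas _) (hmeas _)
    rw [hmxx, hbx, hcx]; linarith only [h]
  have hcovY : 0 ≤ myy - by_ * cy := by
    have h := prodBernoulli_harris w upQb upQc (hmeas _) (hmeas _)
    rw [hmyy, hby, hcy]; linarith only [h]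
  have hcovU : 0 ≤ mU - bU * cU := by
    have h := prodBernoulli_harris w (upPb.union upQb) (upPc.union upQc) (hmeas _) (hmeas _)
    rw [hmU, hbU, hcU]; linarith only [h]
  have hmxxU : mxx ≤ mU := by
    rw [hmxx, hmU]; exact measureReal_mono (Set.inter_subset_inter Set.subset_union_left Set.subset_union_left)
  have hmyyU : myy ≤ mU := by
    rw [hmyy, hmU]; exact measureReal_mono (Set.inter_subset_inter Set.subset_union_right Set.subset_union_right)
  have hbpx0 : 0 ≤ bpx := by rw [hbpx]; exact measureReal_nonneg
  have hbpy0 : 0 ≤ bpy := by rw [hbpy]; exact measureReal_nonneg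
  have hbN0 : 0 ≤ bN := by rw [hbN]; exact measureReal_nonneg
  have hcpx0 : 0 ≤ cpx := by rw [hcpx]; exact measureReal_nonneg
  have hcpy0 : 0 ≤ cpy := by rw [hcpy]; exact measureReal_nonneg
  have hcN0 : 0 ≤ cN := by rw [hcN]; exact measureReal_nonneg
  -- class-law facts
  have hqX0 : 0 ≤ qX := by rw [hqX]; exact measureReal_nonneg
  have hqY0 : 0 ≤ qY := by rw [hqY]; exact measureReal_nonneg
  have hqW0 : 0 ≤ qW := by rw [hqW]; exact measureReal_nonneg
  have ha00 : 0 ≤ a0 := by rw [ha0]; exact measureReal_nonneg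
  have hxu : (prodBernoulli w).real Xu = qX + qW := by rw [hqX, hqW]; exact real_sdiff_add_inter Xu Xv
  have hxv : (prodBernoulli w).real Xv = qY + qW := by rw [hqY, hqW, Set.inter_comm]; exact real_sdiff_add_inter Xv Xu
  have hxuv : (prodBernoulli w).real (Xu ∪ Xv) = qX + qY + qW := by rw [hqX, hqY, hqW]; exact real_union_three Xu Xv
  have upXu : IsUpperSet Xu := by rw [hXu]; exact isUpperSet_connF F s u
  have upXv : IsUpperSet Xv := by rw [hXv]; exact isUpperSet_connF F s v
  have hc' : (qX + qW) * (qY + qW) ≤ qW := by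
    have h := prodBernoulli_harris w upXu upXv (hmeas _) (hmeas _)
    rw [hxu, hxv, ← hqW] at h; exact h
  have hxb1 : qX + qW ≤ 1 := by rw [← hxu]; exact measureReal_le_one
  have hyb1 : qY + qW ≤ 1 := by rw [← hxv]; exact measureReal_le_one
  have hq0 : qX + qW + (qY + qW) - 1 ≤ qW := by
    have h : (prodBernoulli w).real (Xu ∪ Xv) ≤ 1 := measureReal_le_one
    rw [hxuv] at h; linarith only [h]
  -- (R1) at the target `a`
  have ea := twoCut_sahiE3_rootSide_eq w R hs ha hb hc hw hF hXu hXv hBa hVa hUa hPb hQb hPc hQc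
    hζ hqX hqY hqW ha0 haX haY haW hdX hdY hbx hby hbU hbN hcx hcy hcU hcN hmxx hmyy hmU hmN
  -- (R1) at the ports `u` and `v`
  obtain ⟨Vu, hVu⟩ : ∃ S : Set (BondConfig (Fin n)), S = {ω | ω ∩ F ∈ (openConn v u : Set (BondConfig (Fin n)))} := ⟨_, rfl⟩
  obtain ⟨Uu, hUu⟩ : ∃ S : Set (BondConfig (Fin n)), S = {ω | ω ∩ F ∈ (openConn u u : Set (BondConfig (Fin n)))} := ⟨_, rfl⟩
  obtain ⟨Vv, hVv⟩ : ∃ S : Set (BondConfig (Fin n)), S = {ω | ω ∩ F ∈ (openConn v v : Set (BondConfig (Fin n)))} := ⟨_, rfl⟩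
  obtain ⟨Uv, hUv⟩ : ∃ S : Set (BondConfig (Fin n)), S = {ω | ω ∩ F ∈ (openConn u v : Set (BondConfig (Fin n)))} := ⟨_, rfl⟩
  have hUu' : Uu = Set.univ := by
    rw [hUu]; exact Set.eq_univ_of_forall fun ω => (SimpleGraph.Reachable.refl u : (openGraph (ω ∩ F)).Reachable u u)
  have hVv' : Vv = Set.univ := by
    rw [hVv]; exact Set.eq_univ_of_forall fun ω => (SimpleGraph.Reachable.refl v : (openGraph (ω ∩ F)).Reachable v v)
  have su0 : (prodBernoulli w).real (Xu ∩ (Xu ∪ Xv)ᶜ) = 0 := by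
    rw [show Xu ∩ (Xu ∪ Xv)ᶜ = ∅ from Set.eq_empty_of_forall_notMem fun ω h => h.2 (Or.inl h.1), measureReal_empty]
  have suX : (prodBernoulli w).real (Xu ∩ (Xu \ Xv)) = qX := by rw [hqX, Set.inter_eq_self_of_subset_right Set.sdiff_subset]
  have suY : (prodBernoulli w).real (Xu ∩ (Xv \ Xu)) = 0 := by
    rw [show Xu ∩ (Xv \ Xu) = ∅ from Set.eq_empty_of_forall_notMem fun ω h => h.2.2 h.1, measureReal_empty]
  have suW : (prodBernoulli w).real (Xu ∩ (Xu ∩ Xv)) = qW := by rw [hqW, Set.inter_eq_self_of_subset_right Set.inter_subset_left]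
  have sudX : (prodBernoulli w).real ((Xu ∪ Vu) ∩ (Xu \ Xv)) - (prodBernoulli w).real (Xu ∩ (Xu \ Xv)) = 0 := by
    rw [show (Xu ∪ Vu) ∩ (Xu \ Xv) = Xu \ Xv from Set.inter_eq_self_of_subset_right (Set.sdiff_subset.trans Set.subset_union_left),
      Set.inter_eq_self_of_subset_right Set.sdiff_subset, sub_self]
  have sudY : (prodBernoulli w).real ((Xu ∪ Uu) ∩ (Xv \ Xu)) - (prodBernoulli w).real (Xu ∩ (Xv \ Xu)) = qY := by
    rw [hUu', Set.union_univ, Set.univ_inter, suY, sub_zero, hqY]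
  have sv0 : (prodBernoulli w).real (Xv ∩ (Xu ∪ Xv)ᶜ) = 0 := by
    rw [show Xv ∩ (Xu ∪ Xv)ᶜ = ∅ from Set.eq_empty_of_forall_notMem fun ω h => h.2 (Or.inr h.1), measureReal_empty]
  have svX : (prodBernoulli w).real (Xv ∩ (Xu \ Xv)) = 0 := by
    rw [show Xv ∩ (Xu \ Xv) = ∅ from Set.eq_empty_of_forall_notMem fun ω h => h.2.2 h.1, measureReal_empty]
  have svY : (prodBernoulli w).real (Xv ∩ (Xv \ Xu)) = qY := by rw [hqY, Set.inter_eq_self_of_subset_right Set.sdiff_subset]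
  have svW : (prodBernoulli w).real (Xv ∩ (Xu ∩ Xv)) = qW := by rw [hqW, Set.inter_eq_self_of_subset_right Set.inter_subset_right]
  have svdX : (prodBernoulli w).real ((Xv ∪ Vv) ∩ (Xu \ Xv)) - (prodBernoulli w).real (Xv ∩ (Xu \ Xv)) = qX := by
    rw [hVv', Set.union_univ, Set.univ_inter, svX, sub_zero, hqX]
  have svdY : (prodBernoulli w).real ((Xv ∪ Uv) ∩ (Xv \ Xu)) - (prodBernoulli w).real (Xv ∩ (Xv \ Xu)) = 0 := by
    rw [show (Xv ∪ Uv) ∩ (Xv \ Xu) = Xv \ Xu from Set.inter_eq_self_of_subset_right (Set.sdiff_subset.trans Set.subset_union_left),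
      Set.inter_eq_self_of_subset_right Set.sdiff_subset, sub_self]
  have eu := twoCut_sahiE3_rootSide_eq w R hs (Or.inr (Or.inl rfl)) hb hc hw hF hXu hXv hXu hVu hUu hPb hQb hPc hQc
    hζ hqX hqY hqW su0.symm suX.symm suY.symm suW.symm sudX.symm sudY.symm hbx hby hbU hbN hcx hcy hcU hcN hmxx hmyy hmU hmN
  have ev := twoCut_sahiE3_rootSide_eq w R hs (Or.inr (Or.inr rfl)) hb hc hw hF hXu hXv hXv hVv hUv hPb hQb hPc hQc
    hζ hqX hqY hqW sv0.symm svX.symm svY.symm svW.symm svdX.symm svdY.symm hbx hby hbU hbN hcx hcy hcU hcN hmxx hmyy hmU hmN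
  have hMu' := hMu
  rw [eu] at hMu'
  have hMv' := hMv
  rw [ev] at hMv'
  rw [ea]
  -- substitute the outside marginals by the type marginals
  subst hbxs hbys hbUs hcxs hcys hcUs
  -- the A-part real core for u′
  have hA := twoCut_Apart_nonneg (xb := qX + qW) (yb := qY + qW) (w := qW)
    (α := a0 + aX + aY + aW - θu * (qX + qW) - θv * (qY + qW))
    (aX := aX - θu * qX) (aY := aY - θv * qY) (aXY := aW - (θu + θv) * qW)
    (bpx := bpx) (bpy := bpy) (bn := bN) (cpx := cpx) (cpy := cpy) (cn := cN)
    (covX := mxx - (bpx + bN) * (cpx + cN)) (covY := myy - (bpy + bN) * (cpy + cN)) (covU := mU - (bpx + bpy + bN) * (cpx + cpy + cN))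
    hqW0 (by linarith only [hqX0]) (by linarith only [hqY0]) hxb1 hyb1 hc' hq0
    hN1 hN2 hN3 (by linarith only [ha00]) hN4 hN5 hN6 hN7 rfl hN8
    hbpx0 hbpy0 hbN0 hcpx0 hcpy0 hcN0 hcovX hcovY hcovU (by linarith only [hmxxU]) (by linarith only [hmyyU])
    rfl rfl rfl rfl rfl rfl rfl rfl rfl
  -- assembly (B1) + Step 1
  have hprod_u := mul_nonneg hθu0 hMu'
  have hprod_v := mul_nonneg hθv0 hMv'
  subst hθu hθv
  linear_combination hA + hprod_u + hprod_v

end IncStarTwoCut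

end Summit.CriticalPhenomena.PercolationContinuityZ3.Theorems
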